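import Literature.AlgebraicGeometry.Surfaces.NikulinLatticeGluing
import Literature.Topology.FourManifolds.LatticeFormsUnimodularEmbedding
import HarnessLib

/-!
# van Geemen–Sarti §1.11: the even unimodular overlattice `Γ_N ⊃ N ⊕ N` (glued along `q_N = -q_N`) is a
# negative-definite rank-`16` lattice NOT generated by its roots — hence not `E₈(-1)^{⊕2}` ("it is `Γ₁₆(-1)`")

[cite: VanGeemenSarti2007, §1.11 ("The lattices `N ⊕ N` and `Γ₁₆`")]

Family `hodge`, layer `Literature/AlgebraicGeometry/Surfaces` (namespace `Literature.AlgebraicGeometry.Surfaces`).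
Written for lane `lit-hodgefound` (Track 2 foundations; prover seat `lit-hodgefound-p18`, gen 29, row g29-#10), in
the explicit `Λ^*`/residue-code model of `NikulinLatticeGluing.lean` (gen 28, Lemma 1.10). THEOREMS and coordinate
DEFINITIONS WITH BODIES (carrier, forms, glue vectors, code, lattice, residue map, the parity functional); no named
fact, no instance, no notation.

## Source, verbatim (B. van Geemen, A. Sarti, *Nikulin involutions on K3 surfaces*, Math. Z. 255 (2007), §1.11;
held text `paper:arxiv-math_0602015` p0005)

"**1.11 The lattices `N ⊕ N` and `Γ₁₆`.** Using the methods of the proof of Lemma 1.10 we show that any even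
unimodular overlattice `L` of `N ⊕ N` such that `N ⊕ {0}` is primitive in `L`, is isomorphic to `Γ₁₆(-1)`
(cf. [Serre]). The lattice `Γ₁₆(-1)` is the unique even unimodular negative definite lattice which is not generated
by its roots, i.e. by vectors `v` with `v² = -2`. The discriminant form `q_N` of the lattice `N` has values in
`ℤ/2ℤ`, hence `q_N = -q_N`. Therefore isomorphisms `γ : N → N` correspond to the even unimodular overlattices `L_γ`
of `N ⊕ N` with `N ⊕ {0}` primitive in `L_γ`. Since `N ⊕ N` is negative definite, so is `L_γ`. … this lattice has
an index two sublattice (add `x₁ ∈ 2ℤ`) … `N ⊕ N ↪ Γ₁₆(-1)`, `(N_i, 0) ↦ e_i + e_{i+8}`, `(0, N_i) ↦ e_i - e_{i+8}` …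
(note `(N̂, 0) ↦ (Σ e_i)/2 ∈ Γ₁₆`)."

## What is here

The overlattice `Γ_N := L_{id}` of `Λ₀ = (⊕ ℤN_i) ⊕ (⊕ ℤN_i') = ⟨-2⟩^{⊕8} ⊕ ⟨-2⟩^{⊕8}` (carrier `ℤ⁸ × ℤ⁸`,
`nnNodeForm = 2 • nnBaseForm`) generated by the half-vectors `N̂₁ = (Σ N_i)/2` and `((N_0 + N_k) + (N_0' + N_k'))/2`,
`k = 1, …, 7` — i.e. by `N ⊕ N` and the graph of `γ = id : A_N ⥲ A_N`:
* §1–§3 base lattice, the eight glue vectors, the residue code `C ⊂ 𝔽₂^{16}` (`|C| = 2⁸`, `q`-isotropic: finite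
  checks), `Γ_N = L_C`, `r(Γ_N/Λ₀) = C`;
* §4 **`Γ_N` is even, unimodular (`|C|² = 2^{16} = |A_{Λ₀}|`), of rank `16`, signature `-16`, negative definite**;
* §5 **`N ⊕ N ⊂ Γ_N` with both copies primitive**: a half-vector supported on one block lies in `Γ_N` iff its
  numerator is `≡ 0` or `≡ (1,…,1)` mod `2` (`nnBaseForm_inl_mem_iff`, `nnBaseForm_inr_mem_iff`); every code word
  `(x̄, ȳ)` has `ȳ = x̄` or `ȳ = x̄ + (1,…,1)` (`nnWord_diag_or_antidiag`);
* §6 **"not generated by its roots"**: the parity functional `χ = x̄₀ + ȳ₀ : Γ_N → 𝔽₂` kills every root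
  (`nnParity_eq_zero_of_root`: a root `(w/2)` has `Σ wᵢ² = 4 < 8`, so its residue is diagonal) but `χ(N̂₁) = 1`;
  hence `span{roots} ≠ Γ_N` (`span_roots_nnLattice_ne_top`), whereas `E₈(-1)^{⊕2}` IS generated by its roots
  (`span_roots_pi_neg_e8Form_eq_top`), so **`Γ_N ≄ E₈(-1)^{⊕2}`** (`not_equivalent_nnOverlatticeForm_pi_neg_e8Form`).

NOT here: the identification `Γ_N ≅ Γ₁₆(-1) = D₁₆⁺(-1)` itself and the uniqueness statements (they use the
classification of even unimodular lattices of rank `16` and `O(q_N) ≅ S_8`), the root count `480`.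

## References

* [VanGeemenSarti2007] B. van Geemen, A. Sarti, Nikulin involutions on K3 surfaces, Math. Z. 255 (2007), §1.11.
* [Serre1973] J.-P. Serre, A Course in Arithmetic, Ch. V §1.4.3 (`Γ₁₆`, "they do not generate `Γ_{8m}`").
* [Huybrechts2016K3] D. Huybrechts, Lectures on K3 Surfaces, Ch. 14 §0.2 (overlattices ↔ isotropic subgroups).
-/

noncomputable section

open Module Function Matrix
open LinearMap (BilinForm)
open LinearMap.BilinForm
open Literature.Topology.FourManifolds

namespace Literature.AlgebraicGeometry.Surfaces

/-! ### §1 The base lattice `Λ₀ = ⟨-2⟩^{⊕8} ⊕ ⟨-2⟩^{⊕8} = (⊕ ℤN_i) ⊕ (⊕ ℤN_i')` -/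

/-- Carrier of `(⊕ ℤN_i) ⊕ (⊕ ℤN_i')`: the two blocks of node coordinates. [cite: VanGeemenSarti2007, §1.11 ("`N ⊕ N`")] -/
abbrev NNCarrier : Type := (Fin 8 → ℤ) × (Fin 8 → ℤ)

/-- Index set of the coordinates: `(N_i)_i ⊔ (N_i')_i`. [cite: VanGeemenSarti2007, §1.11] -/
abbrev NNIndex : Type := Fin 8 ⊕ Fin 8

/-- The coordinates of a vector. [cite: VanGeemenSarti2007, §1.11] -/
def nnCoord (p : NNCarrier) : NNIndex → ℤ :=
  Sum.elim p.1 p.2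

/-- The coordinate basis. [cite: VanGeemenSarti2007, §1.11] -/
def nnBasis : Basis NNIndex ℤ NNCarrier :=
  (Pi.basisFun ℤ (Fin 8)).prod (Pi.basisFun ℤ (Fin 8))

/-- The basis reads off the coordinates. [cite: VanGeemenSarti2007, §1.11] -/
theorem nnBasis_repr (p : NNCarrier) (i : NNIndex) : nnBasis.repr p i = nnCoord p i := by
  rcases i with i | i
  · rw [nnBasis, Basis.prod_repr_inl, Pi.basisFun_repr]; rfl
  · rw [nnBasis, Basis.prod_repr_inr, Pi.basisFun_repr]; rfl

/-- **The unimodular lattice `Λ₀' = ⟨-1⟩^{⊕8} ⊕ ⟨-1⟩^{⊕8}`** (its twist by `2` is `Λ₀`). [cite: VanGeemenSarti2007, §1.10 ("`N^* ⊂ ℤ(N_i/2)`"), §1.11] -/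
def nnBaseForm : BilinForm ℤ NNCarrier :=
  nikulinBaseForm.prod nikulinBaseForm

/-- `((x,y) . (x',y')) = -x·x' - y·y'`. [cite: VanGeemenSarti2007, §1.11] -/
theorem nnBaseForm_apply (p q : NNCarrier) : nnBaseForm p q = -(p.1 ⬝ᵥ q.1) + -(p.2 ⬝ᵥ q.2) := by
  rw [nnBaseForm, LinearMap.BilinForm.prod_apply, nikulinBaseForm_apply, nikulinBaseForm_apply]

/-- `Λ₀'` is unimodular. [cite: Huybrechts2016K3, Ch. 14 §0.3 (i)] -/
theorem isUnimodular_nnBaseForm : nnBaseForm.IsUnimodular :=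
  isUnimodular_prod_iff.2 ⟨isUnimodular_nikulinBaseForm, isUnimodular_nikulinBaseForm⟩

/-- `Λ₀'` is symmetric. [cite: Huybrechts2016K3, Ch. 14 §0.3] -/
theorem isSymm_nnBaseForm : nnBaseForm.IsSymm :=
  ⟨fun p q ↦ by rw [nnBaseForm_apply, nnBaseForm_apply, dotProduct_comm p.1, dotProduct_comm p.2]⟩

/-- `Λ₀'` is nondegenerate. [cite: Huybrechts2016K3, Ch. 14 §0.1] -/
theorem nondegenerate_nnBaseForm : nnBaseForm.Nondegenerate :=
  isUnimodular_nnBaseForm.nondegenerate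

/-- **`Λ₀ = ⟨-2⟩^{⊕8} ⊕ ⟨-2⟩^{⊕8}`**, the twist `Λ₀'(2)`. [cite: VanGeemenSarti2007, §1.11 ("`N ⊕ N`", `N ⊃ ⟨-2⟩⁸`)] -/
abbrev nnNodeForm : BilinForm ℤ NNCarrier := (2 : ℤ) • nnBaseForm

/-- `Λ₀ = (⊕ ℤN_i) ⊕ (⊕ ℤN_i')` as an orthogonal sum. [cite: VanGeemenSarti2007, §1.11] -/
theorem nnNodeForm_eq_prod : nnNodeForm = nikulinNodeForm.prod nikulinNodeForm :=
  smul_prod _ _ 2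

/-- `Λ₀` is symmetric. [cite: VanGeemenSarti2007, §1.11] -/
theorem isSymm_nnNodeForm : nnNodeForm.IsSymm :=
  nnBaseForm.isSymm_smul_of_isSymm 2 isSymm_nnBaseForm

/-- `Λ₀` is nondegenerate. [cite: VanGeemenSarti2007, §1.11] -/
theorem nondegenerate_nnNodeForm : nnNodeForm.Nondegenerate :=
  (nnBaseForm.nondegenerate_zsmul_iff two_ne_zero).2 nondegenerate_nnBaseForm

/-- `Λ₀` is even. [cite: VanGeemenSarti2007, §1.11] -/
theorem isEven_nnNodeForm : nnNodeForm.IsEven := fun p ↦ ⟨nnBaseForm p p, by rw [smul_apply_apply]; ring⟩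

/-- `|A_{Λ₀}| = 2^{16}`. [cite: VanGeemenSarti2007, §1.11] [cite: Huybrechts2016K3, Ch. 14 §0.3 (iv)] -/
theorem natCard_discriminantGroup_nnNodeForm : Nat.card nnNodeForm.discriminantGroup = 2 ^ 16 := by
  rw [nnBaseForm.natCard_discriminantGroup_smul_of_isUnimodular 2 isUnimodular_nnBaseForm nnBasis]
  simp

/-- `rk Λ₀ = 16`. [cite: VanGeemenSarti2007, §1.11] -/
theorem finrank_nnCarrier : finrank ℤ NNCarrier = 16 := by
  simp [Module.finrank_prod]

/-- **`σ(Λ₀) = -16`.** [cite: VanGeemenSarti2007, §1.11 ("`N ⊕ N` is negative definite")] -/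
theorem signature_nnNodeForm : nnNodeForm.signature = -16 := by
  rw [nnNodeForm_eq_prod, signature_prod _ _ isSymm_nikulinNodeForm isSymm_nikulinNodeForm, signature_nikulinNodeForm]
  rfl

/-! ### §2 The eight half-vectors and the binary code of their residues -/

/-- **The numerators `w₀, …, w₇` of the glue vectors `w_k/2`**: `w₀ = (N_1 + ⋯ + N_8, 0)` (`w₀/2 = N̂₁`), and
`w_k = (N_0 + N_k, N_0' + N_k')`, `k = 1, …, 7` (the graph of `γ = id` on `A_N`: `((N_i+N_j)/2, (N_i'+N_j')/2)`; indices
`0, …, 7`). [cite: VanGeemenSarti2007, §1.11 ("`L_γ`", "`(N̂, 0) ↦ (Σ e_i)/2`")] [cite: VanGeemenSarti2007, §1.10 ("`L_γ := {(u,n) ∈ K^* ⊕ N^* : γ(n̄) = ū}`")] -/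
def nnGlueVec (k : Fin 8) : NNCarrier :=
  if k = 0 then (1, 0) else (Pi.single 0 1 + Pi.single k 1, Pi.single 0 1 + Pi.single k 1)

/-- **The residues `r(w_k/2) ∈ 𝔽₂^{16}`** (coordinates mod `2`). [cite: VanGeemenSarti2007, §1.11] -/
def nnGen (k : Fin 8) (i : NNIndex) : ZMod 2 :=
  ((nnCoord (nnGlueVec k) i : ℤ) : ZMod 2)

/-- The code word with coefficients `c ∈ 𝔽₂⁸`. [cite: VanGeemenSarti2007, §1.11] -/
def nnWord (c : Fin 8 → ZMod 2) (i : NNIndex) : ZMod 2 :=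
  ∑ k, c k * nnGen k i

/-- `c ↦ Σ c_k r(w_k/2)` as a `ℤ`-linear map. [cite: VanGeemenSarti2007, §1.11] -/
def nnCodeMap : (Fin 8 → ZMod 2) →ₗ[ℤ] (NNIndex → ZMod 2) :=
  AddMonoidHom.toIntLinearMap
    { toFun := nnWord
      map_zero' := by funext i; simp [nnWord]
      map_add' := fun c c' ↦ by funext i; simp [nnWord, add_mul, Finset.sum_add_distrib] }

/-- `nnCodeMap c = nnWord c`. [cite: VanGeemenSarti2007, §1.11] -/
@[simp] theorem nnCodeMap_apply (c : Fin 8 → ZMod 2) : nnCodeMap c = nnWord c := rfl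

/-- **The gluing code** `C = ⟨r(w₀/2), …, r(w₇/2)⟩ ⊂ 𝔽₂^{16}`. [cite: VanGeemenSarti2007, §1.11] -/
def nnCode : Submodule ℤ (NNIndex → ZMod 2) :=
  LinearMap.range nnCodeMap

set_option maxRecDepth 16000 in
/-- **The eight residues are linearly independent** (a finite check over the `2⁸` coefficient vectors).
[cite: VanGeemenSarti2007, §1.11] -/
theorem nnWord_injective : ∀ c : Fin 8 → ZMod 2, nnWord c = 0 → c = 0 := by
  decide

/-- `c ↦ Σ c_k r(w_k/2)` is injective. [cite: VanGeemenSarti2007, §1.11] -/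
theorem nnCodeMap_injective : Injective nnCodeMap := by
  intro c c' h
  have h0 : nnWord (c - c') = 0 := by
    have := map_sub nnCodeMap c c'
    rw [h, sub_self] at this
    exact this
  exact sub_eq_zero.1 (nnWord_injective _ h0)

/-- **`|C| = 2⁸`** (`= |A_N|·[N ⊕ N : Λ₀] = 2⁶ · 2²`). [cite: VanGeemenSarti2007, §1.11] -/
theorem natCard_nnCode : Nat.card nnCode = 2 ^ 8 := by
  rw [nnCode, ← Nat.card_congr (LinearEquiv.ofInjective _ nnCodeMap_injective).toEquiv, Nat.card_pi, Nat.card_zmod,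
    Finset.prod_const, Finset.card_univ, Fintype.card_fin]

set_option maxRecDepth 16000 in
/-- **The code is `q`-isotropic**: for every word `(x̄; ȳ) ∈ C` with `{0,1}`-lifts, `4 ∣ #{x̄ = 1} + #{ȳ = 1}` — i.e.
`(w/2)² = -(#ones)/2 ∈ 2ℤ` (a finite check over the `256` words). [cite: VanGeemenSarti2007, §1.11 (via §1.10: "the discriminant form … is identically zero on the subgroup `L/M`")] -/
theorem four_dvd_nnWord : ∀ c : Fin 8 → ZMod 2,
    (4 : ℤ) ∣ ∑ i : Fin 8, ((nnWord c (Sum.inl i)).val : ℤ) + ∑ j : Fin 8, ((nnWord c (Sum.inr j)).val : ℤ) := by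
  decide

set_option maxRecDepth 16000 in
/-- **Every code word `(x̄, ȳ)` is diagonal or antidiagonal: `ȳ = x̄` or `ȳ = x̄ + (1, …, 1)`** (`ū = γ(n̄)`, the two
cosets of `N^*/N` mod `(Σ N_i)/2`; a finite check). [cite: VanGeemenSarti2007, §1.11 ("this lattice has an index two sublattice")] -/
theorem nnWord_diag_or_antidiag : ∀ c : Fin 8 → ZMod 2,
    (∀ j, nnWord c (Sum.inr j) = nnWord c (Sum.inl j)) ∨ ∀ j, nnWord c (Sum.inr j) = nnWord c (Sum.inl j) + 1 := by
  decide

/-- Each generator is a code word. [cite: VanGeemenSarti2007, §1.11] -/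
theorem nnGen_mem_nnCode (k : Fin 8) : nnGen k ∈ nnCode := by
  refine ⟨Pi.single k 1, funext fun i ↦ ?_⟩
  rw [nnCodeMap_apply, nnWord, Finset.sum_eq_single k (fun j _ hj ↦ by rw [Pi.single_eq_of_ne hj, zero_mul])
    (fun h ↦ (h (Finset.mem_univ k)).elim), Pi.single_eq_same, one_mul]

/-- **`C` is the `ℤ`-span of the eight residues.** [cite: VanGeemenSarti2007, §1.11] -/
theorem span_range_nnGen : Submodule.span ℤ (Set.range nnGen) = nnCode := by
  refine le_antisymm (Submodule.span_le.2 ?_) ?_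
  · rintro _ ⟨k, rfl⟩
    exact nnGen_mem_nnCode k
  · rintro _ ⟨c, rfl⟩
    have h : nnCodeMap c = ∑ k, ((c k).val : ℤ) • nnGen k := by
      funext i
      rw [nnCodeMap_apply, nnWord, Finset.sum_apply]
      refine Finset.sum_congr rfl fun k _ ↦ ?_
      rw [Pi.smul_apply, zsmul_eq_mul, Int.cast_natCast, ZMod.natCast_zmod_val]
    rw [h]
    exact Submodule.sum_mem _ fun k _ ↦ Submodule.smul_mem _ _ (Submodule.subset_span ⟨k, rfl⟩)

/-! ### §3 The lattice `Γ_N = Λ₀ + Σ_k ℤ·(w_k/2)` and its subgroup `H ⊂ A_{Λ₀}` -/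

/-- **The overlattice `Γ_N = L_γ` of `N ⊕ N` for `γ = id`** — in `Λ₀^*`: `i_{Λ₀}(Λ₀) + Σ_k ℤ·(w_k/2 . _)`.
[cite: VanGeemenSarti2007, §1.11 ("the even unimodular overlattices `L_γ` of `N ⊕ N`")] -/
def nnLattice : Submodule ℤ (Module.Dual ℤ NNCarrier) :=
  LinearMap.range nnNodeForm ⊔ Submodule.span ℤ (Set.range fun k ↦ nnBaseForm (nnGlueVec k))

/-- `Λ₀ ⊂ Γ_N`. [cite: VanGeemenSarti2007, §1.11] -/
theorem range_nnNodeForm_le : LinearMap.range nnNodeForm ≤ nnLattice :=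
  le_sup_left

/-- The half-vectors lie in `Γ_N`. [cite: VanGeemenSarti2007, §1.11] -/
theorem nnBaseForm_glueVec_mem (k : Fin 8) : nnBaseForm (nnGlueVec k) ∈ nnLattice :=
  Submodule.mem_sup_right (Submodule.subset_span ⟨k, rfl⟩)

/-- **The residue map `r : A_{Λ₀} ⥲ 𝔽₂^{16}`.** [cite: VanGeemenSarti2007, §1.11] [cite: Huybrechts2016K3, Ch. 14 §0.3 (iv)] -/
def nnResidue : nnNodeForm.discriminantGroup ≃ₗ[ℤ] (NNIndex → ZMod 2) :=
  nnBaseForm.discriminantGroupSmulEquivPiZMod 2 isUnimodular_nnBaseForm nnBasis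

/-- `r[(w/2 . _)] = (coordinates of w) mod 2`. [cite: VanGeemenSarti2007, §1.11] -/
theorem nnResidue_mk (w : NNCarrier) :
    nnResidue (Submodule.Quotient.mk (nnBaseForm w)) = fun i ↦ ((nnCoord w i : ℤ) : ZMod 2) := by
  have h := nnBaseForm.discriminantGroupSmulEquivPiZMod_mk_apply 2 isUnimodular_nnBaseForm nnBasis w
  simp only [nnBasis_repr] at h
  exact h

/-- **`H := Γ_N/Λ₀ = ⟨[w_k/2]⟩ ⊂ A_{Λ₀}`.** [cite: VanGeemenSarti2007, §1.11] -/
theorem map_mkQ_nnLattice :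
    nnLattice.map nnNodeForm.discriminantGroupMkQ =
      Submodule.span ℤ (Set.range fun k ↦ (Submodule.Quotient.mk (nnBaseForm (nnGlueVec k)) : nnNodeForm.discriminantGroup)) := by
  have h0 : (LinearMap.range nnNodeForm).map nnNodeForm.discriminantGroupMkQ = ⊥ := Submodule.mkQ_map_self _
  rw [nnLattice, Submodule.map_sup, h0, bot_sup_eq, Submodule.map_span, ← Set.range_comp]
  rfl

/-- **`r(H) = C`.** [cite: VanGeemenSarti2007, §1.11] -/
theorem map_nnResidue_map_mkQ_nnLattice :
    (nnLattice.map nnNodeForm.discriminantGroupMkQ).map nnResidue.toLinearMap = nnCode := by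
  rw [map_mkQ_nnLattice, Submodule.map_span, ← Set.range_comp]
  have h : (⇑nnResidue.toLinearMap ∘ fun k ↦
      (Submodule.Quotient.mk (nnBaseForm (nnGlueVec k)) : nnNodeForm.discriminantGroup)) = nnGen :=
    funext fun k ↦ nnResidue_mk _
  rw [h, span_range_nnGen]

/-- **`|H| = 2⁸`.** [cite: VanGeemenSarti2007, §1.11] -/
theorem natCard_map_mkQ_nnLattice : Nat.card (nnLattice.map nnNodeForm.discriminantGroupMkQ) = 2 ^ 8 := by
  rw [← natCard_nnCode, ← map_nnResidue_map_mkQ_nnLattice]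
  exact Nat.card_congr (nnResidue.submoduleMap _).toEquiv

/-- `Γ_N = L_H`. [cite: VanGeemenSarti2007, §1.11] [cite: Huybrechts2016K3, Ch. 14 §0.2] -/
theorem overlattice_map_mkQ_nnLattice :
    nnNodeForm.overlattice (nnLattice.map nnNodeForm.discriminantGroupMkQ) = nnLattice :=
  nnNodeForm.overlattice_map_mkQ range_nnNodeForm_le

/-- **Coordinates of `Γ_N`**: `(w/2 . _) ∈ Γ_N` iff `w mod 2 ∈ C`. [cite: VanGeemenSarti2007, §1.11] [cite: Huybrechts2016K3, Ch. 14 §0.2 ("`Λ ↦ Λ/Λ' ⊂ A_{Λ'}`")] -/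
theorem nnBaseForm_mem_nnLattice_iff (w : NNCarrier) :
    nnBaseForm w ∈ nnLattice ↔ (fun i ↦ ((nnCoord w i : ℤ) : ZMod 2)) ∈ nnCode := by
  rw [← map_nnResidue_map_mkQ_nnLattice, ← nnResidue_mk w]
  constructor
  · intro hf
    exact Submodule.mem_map_of_mem (Submodule.mem_map_of_mem (f := nnNodeForm.discriminantGroupMkQ) hf)
  · rintro ⟨a, ⟨g, hg, rfl⟩, ha⟩
    rw [LinearEquiv.coe_toLinearMap, nnResidue.injective.eq_iff, discriminantGroupMkQ_apply, Submodule.Quotient.eq] at ha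
    have h : nnBaseForm w = g - (g - nnBaseForm w) := (sub_sub_cancel g _).symm
    rw [h]
    exact Submodule.sub_mem _ hg (range_nnNodeForm_le ha)

/-- **`q_{Λ₀}` vanishes on `H`.** [cite: VanGeemenSarti2007, §1.11 (via §1.10: "identically zero on the subgroup `L/M`")] -/
theorem discriminantQuad_eq_zero_of_mem_map_mkQ_nnLattice (x : nnNodeForm.discriminantGroup)
    (hx : x ∈ nnLattice.map nnNodeForm.discriminantGroupMkQ) :
    nnNodeForm.discriminantQuad nondegenerate_nnNodeForm isSymm_nnNodeForm isEven_nnNodeForm x = 0 := by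
  have hx' : nnResidue x ∈ nnCode := by
    rw [← map_nnResidue_map_mkQ_nnLattice]
    exact Submodule.mem_map_of_mem hx
  obtain ⟨c, hc⟩ := hx'
  set w : NNCarrier := (fun i ↦ ((nnWord c (Sum.inl i)).val : ℤ), fun j ↦ ((nnWord c (Sum.inr j)).val : ℤ)) with hw
  have hxw : x = Submodule.Quotient.mk (nnBaseForm w) := by
    apply nnResidue.injective
    rw [nnResidue_mk, ← hc, nnCodeMap_apply]
    funext i
    rcases i with i | j
    · change nnWord c _ = (((nnWord c (Sum.inl i)).val : ℤ) : ZMod 2)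
      rw [Int.cast_natCast, ZMod.natCast_zmod_val]
    · change nnWord c _ = (((nnWord c (Sum.inr j)).val : ℤ) : ZMod 2)
      rw [Int.cast_natCast, ZMod.natCast_zmod_val]
  rw [hxw]
  change ((2 : ℤ) • nnBaseForm).discriminantQuad _ _ _ (nnBaseForm.twistIncl 2 (Submodule.Quotient.mk w)) = 0
  rw [nnBaseForm.discriminantQuad_smul_twistIncl_mk 2 nondegenerate_nnBaseForm two_ne_zero, nnBaseForm_apply,
    AddCircle.coe_eq_zero_iff]
  obtain ⟨m, hm⟩ := four_dvd_nnWord c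
  have hval : ∀ t : ZMod 2, (t.val : ℤ) * t.val = t.val := by decide
  have h1 : w.1 ⬝ᵥ w.1 = ∑ i : Fin 8, ((nnWord c (Sum.inl i)).val : ℤ) := by
    change ∑ i : Fin 8, ((nnWord c (Sum.inl i)).val : ℤ) * (nnWord c (Sum.inl i)).val = _
    exact Finset.sum_congr rfl fun i _ ↦ hval _
  have h2 : w.2 ⬝ᵥ w.2 = ∑ j : Fin 8, ((nnWord c (Sum.inr j)).val : ℤ) := by
    change ∑ j : Fin 8, ((nnWord c (Sum.inr j)).val : ℤ) * (nnWord c (Sum.inr j)).val = _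
    exact Finset.sum_congr rfl fun j _ ↦ hval _
  refine ⟨-m, ?_⟩
  rw [h1, h2, zsmul_eq_mul]
  have hm' : ((∑ i : Fin 8, ((nnWord c (Sum.inl i)).val : ℤ) + ∑ j : Fin 8, ((nnWord c (Sum.inr j)).val : ℤ) : ℤ) : ℚ) =
      ((4 * m : ℤ) : ℚ) := by rw [hm]
  push_cast at hm' ⊢
  linarith

/-- **The `ℚ`-valued pairing is integral on `Γ_N`.** [cite: VanGeemenSarti2007, §1.11] -/
theorem nnLattice_integral : ∀ f ∈ nnLattice, ∀ g ∈ nnLattice, ∃ n : ℤ, nnNodeForm.dualForm f g = n := by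
  have h := ((nnNodeForm.forall_discriminantQuad_eq_zero_iff_integral_even nondegenerate_nnNodeForm isSymm_nnNodeForm
    isEven_nnNodeForm _).1 discriminantQuad_eq_zero_of_mem_map_mkQ_nnLattice).1
  rwa [overlattice_map_mkQ_nnLattice] at h

/-- `(f . f) ∈ 2ℤ` on `Γ_N`. [cite: VanGeemenSarti2007, §1.11] -/
theorem nnLattice_even : ∀ f ∈ nnLattice, ∃ k : ℤ, nnNodeForm.dualForm f f = 2 * k := by
  have h := ((nnNodeForm.forall_discriminantQuad_eq_zero_iff_integral_even nondegenerate_nnNodeForm isSymm_nnNodeForm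
    isEven_nnNodeForm _).1 discriminantQuad_eq_zero_of_mem_map_mkQ_nnLattice).2
  rwa [overlattice_map_mkQ_nnLattice] at h

/-! ### §4 `Γ_N`: even, unimodular, rank `16`, signature `-16`, negative definite -/

/-- **The lattice `Γ_N`** (the integral form of `nnLattice`). [cite: VanGeemenSarti2007, §1.11 ("`L_γ`")] -/
def nnOverlatticeForm : BilinForm ℤ nnLattice :=
  nnNodeForm.integralForm nnLattice nnLattice_integral

/-- `Γ_N` is symmetric. [cite: VanGeemenSarti2007, §1.11] -/
theorem isSymm_nnOverlatticeForm : nnOverlatticeForm.IsSymm :=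
  nnNodeForm.isSymm_integralForm nondegenerate_nnNodeForm isSymm_nnNodeForm _ _

/-- `Γ_N` is nondegenerate. [cite: VanGeemenSarti2007, §1.11] -/
theorem nondegenerate_nnOverlatticeForm : nnOverlatticeForm.Nondegenerate :=
  nnNodeForm.nondegenerate_integralForm nondegenerate_nnNodeForm isSymm_nnNodeForm _ range_nnNodeForm_le _

/-- **`Γ_N` is even.** [cite: VanGeemenSarti2007, §1.11 ("even unimodular overlattice")] -/
theorem isEven_nnOverlatticeForm : nnOverlatticeForm.IsEven :=
  (nnNodeForm.isEven_integralForm_iff _ _).2 nnLattice_even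

/-- **`Γ_N` is unimodular: `|H|² = 2^{16} = |A_{Λ₀}|`.** [cite: VanGeemenSarti2007, §1.11 ("even unimodular overlattice")] [cite: Huybrechts2016K3, Ch. 14 §0.2] -/
theorem isUnimodular_nnOverlatticeForm : nnOverlatticeForm.IsUnimodular := by
  rw [nnOverlatticeForm, nnNodeForm.isUnimodular_integralForm_iff nondegenerate_nnNodeForm isSymm_nnNodeForm _
    range_nnNodeForm_le, natCard_map_mkQ_nnLattice, natCard_discriminantGroup_nnNodeForm]
  norm_num

/-- **`rk Γ_N = 16`.** [cite: VanGeemenSarti2007, §1.11] -/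
theorem finrank_nnLattice : finrank ℤ nnLattice = 16 := by
  rw [nnNodeForm.finrank_overlattice_eq nondegenerate_nnNodeForm _ range_nnNodeForm_le, finrank_nnCarrier]

/-- **`σ(Γ_N) = -16`.** [cite: VanGeemenSarti2007, §1.11 ("Since `N ⊕ N` is negative definite, so is `L_γ`")] [cite: Serre1973, Ch. V §1.3.2] -/
theorem signature_nnOverlatticeForm : nnOverlatticeForm.signature = -16 := by
  rw [nnOverlatticeForm, nnNodeForm.signature_integralForm nondegenerate_nnNodeForm isSymm_nnNodeForm _
    range_nnNodeForm_le, signature_nnNodeForm]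

/-- **`Γ_N` is negative definite.** [cite: VanGeemenSarti2007, §1.11 ("so is `L_γ`")] -/
theorem negDef_nnOverlatticeForm : nnOverlatticeForm.NegDef := by
  rw [negDef_iff_signature_eq_neg_finrank isSymm_nnOverlatticeForm nondegenerate_nnOverlatticeForm.1,
    signature_nnOverlatticeForm, finrank_nnLattice]
  rfl

/-- `Λ₀ ⊂ Γ_N` is a sublattice: `(i x . i y)_Γ = (x . y)_{Λ₀}`. [cite: VanGeemenSarti2007, §1.11] -/
theorem nnOverlatticeForm_toOverlattice (x y : NNCarrier) :
    nnOverlatticeForm (nnNodeForm.toOverlattice nnLattice range_nnNodeForm_le x)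
      (nnNodeForm.toOverlattice nnLattice range_nnNodeForm_le y) = nnNodeForm x y :=
  nnNodeForm.integralForm_toOverlattice nondegenerate_nnNodeForm isSymm_nnNodeForm _ _ _ x y

/-- **`2 (w/2 . w'/2)_Γ = (w . w')_{Λ₀'} = -x·x' - y·y'`** for two elements of `Γ_N ⊂ Λ₀^*`. [cite: VanGeemenSarti2007, §1.10 ("`(e/2)² = 0`, `(e/2)(f/2) = 1/2`" — the `ℚ`-valued form on `M^*`)] -/
theorem two_mul_nnOverlatticeForm_mk (w w' : NNCarrier) (hw : nnBaseForm w ∈ nnLattice) (hw' : nnBaseForm w' ∈ nnLattice) :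
    2 * nnOverlatticeForm ⟨nnBaseForm w, hw⟩ ⟨nnBaseForm w', hw'⟩ = nnBaseForm w w' := by
  have h : ((nnOverlatticeForm ⟨nnBaseForm w, hw⟩ ⟨nnBaseForm w', hw'⟩ : ℤ) : ℚ) = (nnBaseForm w w' : ℚ) / 2 := by
    rw [nnOverlatticeForm, nnNodeForm.integralForm_apply]
    change ((2 : ℤ) • nnBaseForm).dualForm (nnBaseForm w) (nnBaseForm w') = _
    rw [nnBaseForm.dualForm_smul_apply_apply 2 nondegenerate_nnBaseForm two_ne_zero, isSymm_nnBaseForm.eq w' w]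
    push_cast
    ring
  have h2 : (((2 * nnOverlatticeForm ⟨nnBaseForm w, hw⟩ ⟨nnBaseForm w', hw'⟩ : ℤ)) : ℚ) = ((nnBaseForm w w' : ℤ) : ℚ) := by
    rw [Int.cast_mul, h, Int.cast_ofNat]
    ring
  exact_mod_cast h2

/-! ### §5 `N ⊕ N ⊂ Γ_N`, both copies primitive -/

/-- `N̂₁ = w₀/2 = ((Σ N_i)/2, 0) ∈ Γ_N`. [cite: VanGeemenSarti2007, §1.11 ("`(N̂, 0)`")] -/
theorem nnBaseForm_one_zero_mem : nnBaseForm (1, 0) ∈ nnLattice := by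
  have h : nnGlueVec 0 = (1, 0) := by rw [nnGlueVec, if_pos rfl]
  rw [← h]
  exact nnBaseForm_glueVec_mem 0

set_option maxRecDepth 16000 in
/-- The residue of `(0, Σ N_i')/2` is the code word with all coefficients `1` (a finite check). [cite: VanGeemenSarti2007, §1.11 ("`(0, N̂)`")] -/
theorem nnWord_one_eq : nnWord (fun _ ↦ 1) = fun i ↦ ((nnCoord ((0, 1) : NNCarrier) i : ℤ) : ZMod 2) := by
  decide

/-- `N̂₂ = (0, (Σ N_i')/2) ∈ Γ_N`. [cite: VanGeemenSarti2007, §1.11 ("`(0, N̂) ↦ ((Σ_{i≤8} e_i) - (Σ_{i>8} e_i))/2 ∈ Γ₁₆`")] -/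
theorem nnBaseForm_zero_one_mem : nnBaseForm (0, 1) ∈ nnLattice :=
  (nnBaseForm_mem_nnLattice_iff _).2 ⟨fun _ ↦ 1, nnWord_one_eq⟩

/-- Half-vectors supported on one block with numerator `≡ 0` or `≡ (1, …, 1)` lie in `Γ_N` (they form `N ⊕ 0`,
resp. `0 ⊕ N`). [cite: VanGeemenSarti2007, §1.11 ("overlattices … of `N ⊕ N`")] [cite: VanGeemenSarti2007, §1.5 ("`N = ⟨N_i, N̂⟩`")] -/
theorem nnBaseForm_inl_mem {x : Fin 8 → ℤ} (h : (∀ j, Even (x j)) ∨ ∀ j, Odd (x j)) : nnBaseForm (x, 0) ∈ nnLattice := by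
  rcases h with h | h
  · choose m hm using h
    have hx : ((x, 0) : NNCarrier) = (2 : ℤ) • ((m, 0) : NNCarrier) := by
      refine Prod.ext (funext fun j ↦ ?_) (by simp)
      change x j = 2 * m j
      rw [hm j, two_mul]
    rw [hx, map_smul]
    exact range_nnNodeForm_le ⟨(m, 0), rfl⟩
  · choose m hm using h
    have hx : ((x, 0) : NNCarrier) = (1, 0) + (2 : ℤ) • ((m, 0) : NNCarrier) := by
      refine Prod.ext (funext fun j ↦ ?_) (by simp)
      change x j = 1 + 2 * m j
      rw [hm j]; ring
    rw [hx, map_add, map_smul]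
    exact add_mem nnBaseForm_one_zero_mem (range_nnNodeForm_le ⟨(m, 0), rfl⟩)

/-- The same for the second block. [cite: VanGeemenSarti2007, §1.11] -/
theorem nnBaseForm_inr_mem {y : Fin 8 → ℤ} (h : (∀ j, Even (y j)) ∨ ∀ j, Odd (y j)) : nnBaseForm (0, y) ∈ nnLattice := by
  rcases h with h | h
  · choose m hm using h
    have hy : ((0, y) : NNCarrier) = (2 : ℤ) • ((0, m) : NNCarrier) := by
      refine Prod.ext (by simp) (funext fun j ↦ ?_)
      change y j = 2 * m j
      rw [hm j, two_mul]
    rw [hy, map_smul]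
    exact range_nnNodeForm_le ⟨(0, m), rfl⟩
  · choose m hm using h
    have hy : ((0, y) : NNCarrier) = (0, 1) + (2 : ℤ) • ((0, m) : NNCarrier) := by
      refine Prod.ext (by simp) (funext fun j ↦ ?_)
      change y j = 1 + 2 * m j
      rw [hm j]; ring
    rw [hy, map_add, map_smul]
    exact add_mem nnBaseForm_zero_one_mem (range_nnNodeForm_le ⟨(0, m), rfl⟩)

/-- From a code membership of the residue of `w = (x, y)`: `ȳ = x̄` or `ȳ = x̄ + 1` coordinatewise.
[cite: VanGeemenSarti2007, §1.11] -/
theorem residue_diag_or_antidiag {w : NNCarrier} (hw : nnBaseForm w ∈ nnLattice) :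
    (∀ j, ((w.2 j : ℤ) : ZMod 2) = ((w.1 j : ℤ) : ZMod 2)) ∨ ∀ j, ((w.2 j : ℤ) : ZMod 2) = ((w.1 j : ℤ) : ZMod 2) + 1 := by
  obtain ⟨c, hc⟩ := (nnBaseForm_mem_nnLattice_iff w).1 hw
  rw [nnCodeMap_apply] at hc
  have h1 : ∀ j, nnWord c (Sum.inl j) = ((w.1 j : ℤ) : ZMod 2) := fun j ↦ congrFun hc (Sum.inl j)
  have h2 : ∀ j, nnWord c (Sum.inr j) = ((w.2 j : ℤ) : ZMod 2) := fun j ↦ congrFun hc (Sum.inr j)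
  rcases nnWord_diag_or_antidiag c with h | h
  · exact Or.inl fun j ↦ by rw [← h2, ← h1, h j]
  · exact Or.inr fun j ↦ by rw [← h2, ← h1, h j]

/-- **`N ⊕ {0}` is primitive in `Γ_N`: `Γ_N ∩ (N ⊕ 0)_ℚ = N ⊕ 0`** — a half-vector `((Σ x_jN_j)/2, 0)` lies in `Γ_N`
iff all `x_j` are even or all are odd. [cite: VanGeemenSarti2007, §1.11 ("such that `N ⊕ {0}` is primitive in `L`")] -/
theorem nnBaseForm_inl_mem_iff (x : Fin 8 → ℤ) :
    nnBaseForm (x, 0) ∈ nnLattice ↔ (∀ j, Even (x j)) ∨ ∀ j, Odd (x j) := by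
  refine ⟨fun h ↦ ?_, nnBaseForm_inl_mem⟩
  rcases residue_diag_or_antidiag h with h0 | h0
  · left
    intro j
    have := h0 j
    simp only [Pi.zero_apply, Int.cast_zero] at this
    have h2 : ((x j : ℤ) : ZMod 2) = 0 := this.symm
    rw [ZMod.intCast_zmod_eq_zero_iff_dvd] at h2
    exact even_iff_two_dvd.2 (by exact_mod_cast h2)
  · right
    intro j
    have := h0 j
    simp only [Pi.zero_apply, Int.cast_zero] at this
    rw [← Int.not_even_iff_odd, even_iff_two_dvd]
    intro hd
    have h2 : ((x j : ℤ) : ZMod 2) = 0 := (ZMod.intCast_zmod_eq_zero_iff_dvd (x j) 2).2 (by exact_mod_cast hd)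
    rw [h2, zero_add] at this
    exact zero_ne_one this

/-- **`{0} ⊕ N` is primitive in `Γ_N`** likewise. [cite: VanGeemenSarti2007, §1.11] -/
theorem nnBaseForm_inr_mem_iff (y : Fin 8 → ℤ) :
    nnBaseForm (0, y) ∈ nnLattice ↔ (∀ j, Even (y j)) ∨ ∀ j, Odd (y j) := by
  refine ⟨fun h ↦ ?_, nnBaseForm_inr_mem⟩
  rcases residue_diag_or_antidiag h with h0 | h0
  · left
    intro j
    have h2 : ((y j : ℤ) : ZMod 2) = 0 := by simpa only [Pi.zero_apply, Int.cast_zero] using h0 j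
    rw [ZMod.intCast_zmod_eq_zero_iff_dvd] at h2
    exact even_iff_two_dvd.2 (by exact_mod_cast h2)
  · right
    intro j
    have h1 : ((y j : ℤ) : ZMod 2) = 0 + 1 := by simpa only [Pi.zero_apply, Int.cast_zero] using h0 j
    rw [← Int.not_even_iff_odd, even_iff_two_dvd]
    intro hd
    have h2 : ((y j : ℤ) : ZMod 2) = 0 := (ZMod.intCast_zmod_eq_zero_iff_dvd (y j) 2).2 (by exact_mod_cast hd)
    rw [h2, zero_add] at h1
    exact zero_ne_one h1

/-- **`(N_i, 0)` and `(0, N_i')` are roots of `Γ_N`.** [cite: VanGeemenSarti2007, §1.11 ("roots, i.e. vectors `v` with `v² = -2`")] -/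
theorem nnOverlatticeForm_node (i : Fin 8) :
    nnOverlatticeForm (nnNodeForm.toOverlattice nnLattice range_nnNodeForm_le (Pi.single i 1, 0))
        (nnNodeForm.toOverlattice nnLattice range_nnNodeForm_le (Pi.single i 1, 0)) = -2 ∧
      nnOverlatticeForm (nnNodeForm.toOverlattice nnLattice range_nnNodeForm_le (0, Pi.single i 1))
        (nnNodeForm.toOverlattice nnLattice range_nnNodeForm_le (0, Pi.single i 1)) = -2 := by
  constructor <;> · rw [nnOverlatticeForm_toOverlattice, smul_apply_apply, nnBaseForm_apply]; simp

/-! ### §6 `Γ_N` is not generated by its roots; `Γ_N ≄ E₈(-1)^{⊕2}` -/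

/-- Every functional on `Λ₀` is `(w/2 . _)` for a (unique) `w` (`Λ₀^* = ½Λ₀'`). [cite: VanGeemenSarti2007, §1.10 ("`N^* ⊂ ℤ(N_i/2)`")] -/
theorem exists_eq_nnBaseForm (f : Module.Dual ℤ NNCarrier) : ∃ w, f = nnBaseForm w := by
  haveI : nnBaseForm.IsPerfPair := isUnimodular_nnBaseForm
  obtain ⟨w, hw⟩ := (LinearMap.IsPerfPair.bijective_left nnBaseForm).2 f
  exact ⟨w, hw.symm⟩

/-- `y mod 2 ≤ y²`. [folklore] -/
private theorem emod_two_le_mul_self (y : ℤ) : y % 2 ≤ y * y := by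
  rcases Int.emod_two_eq_zero_or_one y with h | h
  · rw [h]; exact mul_self_nonneg y
  · rw [h]
    have hy : y ≠ 0 := by rintro rfl; simp at h
    rcases lt_or_gt_of_ne hy with hlt | hgt <;> nlinarith

/-- The number of odd coordinates of `w ∈ ℤⁿ` is at most `w.w`. [folklore] -/
private theorem sum_emod_two_le_dotProduct_self (y : Fin 8 → ℤ) : ∑ i, y i % 2 ≤ y ⬝ᵥ y :=
  Finset.sum_le_sum fun i _ ↦ emod_two_le_mul_self (y i)

/-- **The parity functional `χ : Γ_N → 𝔽₂`, `(w/2 . _) ↦ w₀ + w₀' mod 2`** — it cuts out the index-two sublattice of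
diagonal residues. [cite: VanGeemenSarti2007, §1.11 ("this lattice has an index two sublattice")] -/
def nnParity : nnLattice →ₗ[ℤ] ZMod 2 :=
  ((LinearMap.proj (R := ℤ) (φ := fun _ : NNIndex ↦ ZMod 2) (Sum.inl 0) +
      LinearMap.proj (R := ℤ) (φ := fun _ : NNIndex ↦ ZMod 2) (Sum.inr 0)) ∘ₗ
    nnResidue.toLinearMap ∘ₗ nnNodeForm.discriminantGroupMkQ) ∘ₗ nnLattice.subtype

/-- `χ(w/2) = w₀ + w₀' mod 2`. [cite: VanGeemenSarti2007, §1.11] -/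
theorem nnParity_mk (w : NNCarrier) (hw : nnBaseForm w ∈ nnLattice) :
    nnParity ⟨nnBaseForm w, hw⟩ = ((w.1 0 : ℤ) : ZMod 2) + ((w.2 0 : ℤ) : ZMod 2) := by
  have h : nnParity ⟨nnBaseForm w, hw⟩ = nnResidue (Submodule.Quotient.mk (nnBaseForm w)) (Sum.inl 0) +
      nnResidue (Submodule.Quotient.mk (nnBaseForm w)) (Sum.inr 0) := rfl
  rw [h, nnResidue_mk]
  rfl

/-- **`χ(N̂₁) = 1`**: the glue vector `((Σ N_i)/2, 0)` is not in the index-two sublattice. [cite: VanGeemenSarti2007, §1.11 ("`(N̂, 0) ↦ (Σ e_i)/2`")] -/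
theorem nnParity_hat : nnParity ⟨nnBaseForm (1, 0), nnBaseForm_one_zero_mem⟩ = 1 := by
  rw [nnParity_mk]
  simp

/-- **Every root of `Γ_N` lies in the index-two sublattice `ker χ`**: a root `w/2` has `Σ wᵢ² = 4`, hence at most
four odd coordinates, so its residue `(x̄, ȳ)` is diagonal (`ȳ = x̄`; the antidiagonal coset has eight odd
coordinates). [cite: VanGeemenSarti2007, §1.11 ("not generated by its roots, i.e. by vectors `v` with `v² = -2`")] -/
theorem nnParity_eq_zero_of_root (f : nnLattice) (hf : nnOverlatticeForm f f = -2) : nnParity f = 0 := by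
  obtain ⟨f, hfm⟩ := f
  obtain ⟨w, rfl⟩ := exists_eq_nnBaseForm f
  have h2 := two_mul_nnOverlatticeForm_mk w w hfm hfm
  rw [hf, nnBaseForm_apply] at h2
  have h4 : w.1 ⬝ᵥ w.1 + w.2 ⬝ᵥ w.2 = 4 := by linarith
  rw [nnParity_mk]
  rcases residue_diag_or_antidiag hfm with hd | ha
  · rw [hd 0, ← two_mul]
    have : ∀ t : ZMod 2, 2 * t = 0 := by decide
    exact this _
  · exfalso
    -- antidiagonal: exactly one of `w.1 j`, `w.2 j` is odd for every `j`: eight odd coordinates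
    have hodd : ∀ j, w.1 j % 2 + w.2 j % 2 = 1 := fun j ↦ by
      have h := ha j
      rw [← Int.cast_one, ← Int.cast_add, ZMod.intCast_eq_intCast_iff_dvd_sub] at h
      omega
    have h8 : (8 : ℤ) ≤ w.1 ⬝ᵥ w.1 + w.2 ⬝ᵥ w.2 := by
      have hs : ∑ j : Fin 8, (w.1 j % 2 + w.2 j % 2) = 8 := by
        rw [Finset.sum_congr rfl fun j _ ↦ hodd j]; simp
      have hle := add_le_add (sum_emod_two_le_dotProduct_self w.1) (sum_emod_two_le_dotProduct_self w.2)
      rw [← Finset.sum_add_distrib, hs] at hle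
      exact hle
    omega

/-- **`Γ_N` is not generated by its roots**: the roots span a sublattice contained in the index-two sublattice
`ker χ ∌ N̂₁`. [cite: VanGeemenSarti2007, §1.11 ("`Γ₁₆(-1)` … is not generated by its roots")] [cite: Serre1973, Ch. V §1.4.3 ("they do not generate `Γ_{8m}`")] -/
theorem span_roots_nnLattice_ne_top :
    Submodule.span ℤ {f : nnLattice | nnOverlatticeForm f f = -2} ≠ ⊤ := by
  intro h
  have hle : Submodule.span ℤ {f : nnLattice | nnOverlatticeForm f f = -2} ≤ LinearMap.ker nnParity :=
    Submodule.span_le.2 fun f hf ↦ LinearMap.mem_ker.2 (nnParity_eq_zero_of_root f hf)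
  rw [h, top_le_iff, LinearMap.ker_eq_top] at hle
  have h1 := nnParity_hat
  rw [hle, LinearMap.zero_apply] at h1
  exact zero_ne_one h1

/-- **`E₈(-1)^{⊕2}` is generated by its roots** (the `16` basis vectors `α_i` of the two root systems have
`(α_i.α_i) = -2`). [cite: Serre1973, Ch. V §1.4.3 ("There are `240` elements `x ∈ Γ₈` such that `x.x = 2` … they generate `Γ₈`")] [cite: Huybrechts2016K3, Ch. 14 §0.3 (iii) (`E₈` and its Cartan matrix)] -/
theorem span_roots_pi_neg_e8Form_eq_top :
    Submodule.span ℤ {v : Fin 2 → Fin 8 → ℤ | (LinearMap.BilinForm.pi fun _ : Fin 2 ↦ -e8Form) v v = -2} = ⊤ := by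
  have hdiag : ∀ i : Fin 8, CartanMatrix.E₈ i i = 2 := by decide
  rw [eq_top_iff, ← (Pi.basis fun _ : Fin 2 ↦ Pi.basisFun ℤ (Fin 8)).span_eq, Submodule.span_le]
  rintro _ ⟨ai, rfl⟩
  obtain ⟨a, i⟩ := ai
  refine Submodule.subset_span ?_
  show (LinearMap.BilinForm.pi fun _ : Fin 2 ↦ -e8Form) _ _ = -2
  rw [Pi.basis_apply]
  dsimp only
  rw [Pi.basisFun_apply, LinearMap.BilinForm.pi_apply,
    Finset.sum_eq_single a (fun b _ hb ↦ by rw [Pi.single_eq_of_ne hb]; simp)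
      (fun h ↦ (h (Finset.mem_univ a)).elim), Pi.single_eq_same, LinearMap.neg_apply, LinearMap.neg_apply, e8Form,
    Matrix.toBilin'_apply', Matrix.mulVec_single_one, dotProduct_comm, dotProduct_single, mul_one, Matrix.col_apply,
    hdiag]

/-- An isometry carries the span of the roots onto the span of the roots. [cite: VanGeemenSarti2007, §1.11] -/
theorem map_span_roots_of_isometryEquiv {V V' : Type*} [AddCommGroup V] [AddCommGroup V'] {Q : BilinForm ℤ V}
    {Q' : BilinForm ℤ V'} (e : Q.IsometryEquiv Q') :
    (Submodule.span ℤ {v : V | Q v v = -2}).map (e.toLinearEquiv : V →ₗ[ℤ] V') = Submodule.span ℤ {v : V' | Q' v v = -2} := by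
  rw [Submodule.map_span]
  congr 1
  ext v'
  simp only [Set.mem_image, Set.mem_setOf_eq, LinearEquiv.coe_coe]
  constructor
  · rintro ⟨v, hv, rfl⟩
    rw [← hv]
    exact e.map_app v v
  · intro hv'
    refine ⟨e.toLinearEquiv.symm v', ?_, e.toLinearEquiv.apply_symm_apply v'⟩
    rw [← hv', ← e.map_app (e.toLinearEquiv.symm v') (e.toLinearEquiv.symm v')]
    exact congrArg₂ (fun a b ↦ Q' a b) (e.toLinearEquiv.apply_symm_apply v') (e.toLinearEquiv.apply_symm_apply v')

/-- **`Γ_N ≄ E₈(-1)^{⊕2}`**: the even unimodular negative-definite rank-`16` lattice `Γ_N ⊃ N ⊕ N` is not the root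
lattice `E₈(-1)^{⊕2}` (it is the other one, `Γ₁₆(-1)`, by the classification in rank `16` — not formalised).
[cite: VanGeemenSarti2007, §1.11 ("is isomorphic to `Γ₁₆(-1)` … the unique even unimodular negative definite lattice which is not generated by its roots")] [cite: Serre1973, Ch. V §1.4.3 ("`Γ₈ ⊕ Γ₈` is not isomorphic to `Γ₁₆`")] -/
theorem not_equivalent_nnOverlatticeForm_pi_neg_e8Form :
    ¬ nnOverlatticeForm.Equivalent (LinearMap.BilinForm.pi fun _ : Fin 2 ↦ -e8Form) := by
  rintro ⟨e⟩
  apply span_roots_nnLattice_ne_top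
  have h := map_span_roots_of_isometryEquiv e
  rw [span_roots_pi_neg_e8Form_eq_top] at h
  apply_fun Submodule.comap (e.toLinearEquiv : nnLattice →ₗ[ℤ] (Fin 2 → Fin 8 → ℤ)) at h
  rwa [Submodule.comap_map_eq_of_injective e.toLinearEquiv.injective, Submodule.comap_top] at h

end Literature.AlgebraicGeometry.Surfaces
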